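import Mathlib
import HarnessLib
import Summits.HubbardSuperconductivity.HubbardSuperconductivity.Theorems.KLProgrammeKLRegimeCountertermReadingRegime
import Summits.HubbardSuperconductivity.HubbardSuperconductivity.Theorems.KLProgrammeKLRegimeCountertermPolarAngleRay
import Summits.HubbardSuperconductivity.HubbardSuperconductivity.Theorems.KLProgrammeKLRegimeCountertermProfileSymmetry
import Summits.HubbardSuperconductivity.HubbardSuperconductivity.Theorems.KLProgrammeKLRegimeSplitModelCongr

/-!
# Route `KLProgramme` — the Counterterm child of crux K3 under Δ23 / (R-I-min) (gen 5: `CountertermP2 klPredsV13 klWindowC`,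
# BundleV13 p484180): THE READING OF `ν_n(K)` THROUGH THE FUNCTION PIECES IS AN IDENTITY
# (seat hubbard-kl-k3c3-p1 g3, row «δμ-flow with `klAngularMean` constant piece»; (R-I-min) twin of parts C/D/E
# `…CountertermReading/ReadingFrame/ReadingRegime`)

Under V6–V12 the two-leg pieces were trigonometric INTERPOLANTS `ℓ_i^G(K) = klTwoLegPieceG …` and the one-volume construction of child
Counterterm read `|ν_n(K)(θ)|` off a sup bound of the polynomial `K ⊕ Σ_{i ≤ n} ℓ_i^G(K)` through the READING INEQUALITY
`|ν_n(K)(θ) − (K(q_θ) + Σ_{i ≤ n} ℓ_i^G(K)(q_θ))| ≤ Λ_ℓ·2π/L + (Λ_ν + Λ_K)·π·(2π/L)/r₀` (parts C/D/E; k3c3-p2's `ct_reading_of_blockHA`),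
which needed the mesh wiggle, an angular Lipschitz constant of `ν_n(K)` ((E3g₁)), a sup-metric Lipschitz constant of the partial sum
((E3a) `j = 1`), the frame-on-curve constant `Λ_K`, the radius floor `r₀` and the volume conditions `L ≥ max(20, 8π/klFlatR)`, `2π/L < r₀`.

Under (R-I-min) (plan g12 RULING-DRAFT 2026-08-27T01:33:11Z + (R2′); `…SplitBundleV13`) the pieces are the FUNCTIONS
`klTwoLegPieceFn L M β U μ K.eval i` (`…SplitFrameFn`), built from the de-interpolated G-extension
`klFrameExtFn μ f p = mean f + χ_flat(p)·(f(polarAngle p̃) − mean f)`, and the reading is EXACT: at the frame's Fermi point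
`q_θ = klFermiPoint μ K θ = u_K(θ)·dir θ` one has `ε(q_θ) − μ = K(q_θ)` with `|K(q_θ)| ≤ A ≤ klFlatR` (flat tube: `χ_flat(q_θ) = 1`),
`q_θ` lies in the open square (`centredRep q_θ = q_θ`) and `polarAngle (u·dir θ) = θ mod 2π` (`u > 0`), so for every `2π`-periodic profile
`klFrameExtFn μ f (q_θ) = f θ`; with the telescoping `Σ_{i ≤ n} ℓ_i^{Fn} = D_n − P` (`sum_klTwoLegPieceFn`) and the model congruence
`D_n(K.eval) = klFrameExtFn μ (ν_n(K))` (`klTwoLegPolyFn_eval`, p2):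

  **`klLocalPart L M β U μ K n θ = K.eval q_θ + Σ_{i ∈ range (n+1)} klTwoLegPieceFn L M β U μ K.eval i q_θ`** — no `1/L` term, no Lipschitz
  constant, no radius floor, no volume condition (k3c3-p2 DELTA23-CHILD2 §1: «the reading layer RETIRES; `wig := 0`»).

Contents: §1 under p4's explicit frame hypotheses (`B : BandBounds a b`, `C²`-size `A` of `frameShift K`, `[μ − A, μ + A] ⊂ [a, b]`, and
`A ≤ klFlatR` where the tube is read): `centredRep_eq_self_of_abs_lt`, `freeBandFn_klFermiPoint_sub`, `klFlatCutoffFn_klFermiPoint`,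
`klFrameExtFn_apply_klFermiPoint`, `klTwoLegPolyFn_eval_apply_klFermiPoint`, `klFrameProjFn_eval_apply_klFermiPoint`, the pieces at `q_θ`
(`klTwoLegPieceFn_eval_apply_klFermiPoint_zero/_succ`), **`klLocalPart_eq_eval_add_sum_pieceFn`**, and the gate corollaries
`abs_klLocalPart_le_of_partialSumFn` / `renormalisedAtF_of_partialSumFn`; §2 the same keyed by `FrameOK R U (nScales β) ν K` in the KL regime
(`klLocalPart_eq_partialSumFn_of_frameOK`, `renormalisedAtF_of_partialSumFn_frameOK`: thresholds `c₃, U₀` from `frame_thresholds` only — the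
shape of `contDiff_klLocalPart_of_frameOK` / `…ReadingRegime` minus every wiggle datum); §3 the δμ-FLOW READ AT THE ZONE CENTRE for the
function pieces (`μ ≥ −3.9`: the doubled tube misses `Γ`): `klFrameExtFn_apply_zero = klAngularMean`, `klTwoLegPolyFn_eval_apply_zero`,
`klFrameProjFn_eval_apply_zero`, `sum_klTwoLegPieceFn_eval_apply_zero` — the constant pieces of the counterterm iterates ARE the increments of
the angular means.  Proofs only; nothing is asserted about the Hubbard model.  Reference for the Fermi-point geometry: BGM 2006 §2.4
Lemma 2.1 (2.40) (tree: `…PerturbedFermiCurveDefs`).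
-/

noncomputable section

namespace Summit.HubbardSuperconductivity.HubbardSuperconductivity.Theorems.KLRegimeSplit

set_option linter.dupNamespace false -- summit = problem name (single-conjunct summit), D-0017

open Real Finset MeasureTheory Set
open Literature.MathematicalPhysics.QuantumLattice Literature.Probability.LatticeModels
open Literature.MathematicalPhysics.QuantumLattice.BandSectorCounting
open Literature.MathematicalPhysics.QuantumLattice.FermiRG
open Summit.HubbardSuperconductivity.HubbardSuperconductivity.Theorems.KLProgrammeLegKernels
open Summit.HubbardSuperconductivity.HubbardSuperconductivity.Theorems.PerturbedFermiCurve
open Summit.HubbardSuperconductivity.HubbardSuperconductivity.Theorems.DispersionFlow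

/-! ## §0 Two value-level facts on continuum momenta -/

/-- **A point of the open square is its own centred representative**: `|p_i| < π` for both `i` ⇒ `centredRep p = p`. -/
theorem centredRep_eq_self_of_abs_lt {p : Fin 2 → ℝ} (h : ∀ i, |p i| < π) : centredRep p = p := by
  funext i
  have hi := abs_lt.1 (h i)
  show toIocMod Real.two_pi_pos (-π) (p i) = p i
  rw [toIocMod_eq_self]
  constructor <;> linarith [hi.1, hi.2]

/-- The continuum free band of `…SplitFrameFn` is the tree's `sqDispersion` (same expression). -/
theorem freeBandFn_eq_sqDispersion (p : Fin 2 → ℝ) : freeBandFn p = sqDispersion p := rfl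

/-! ## §1 The reading identity under the explicit frame hypotheses -/

section Frame

variable {a b : ℝ} (B : BandBounds a b) {K : TrigPolyC4v} {A : ℝ}
  (hA : ∀ p : Momentum, ∀ j ≤ 2, ‖iteratedFDeriv ℝ j (frameShift K) p‖ ≤ A) {μ : ℝ} (hlo : a ≤ μ - A) (hhi : μ + A ≤ b)
include B hA hlo hhi

/-- **The Fermi point lies on the frame's curve, `freeBandFn` spelling**: `ε(q_θ) − μ = K(q_θ)`. -/
theorem freeBandFn_klFermiPoint_sub (θ : ℝ) : freeBandFn (klFermiPoint μ K θ) - μ = K.eval (klFermiPoint μ K θ) := by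
  have h := eps2_klFermiPoint_eq B hA hlo hhi θ
  rw [freeBandFn_eq_sqDispersion, sqDispersion_eq_eps2]
  linarith

/-- **The flat cutoff is `1` at the Fermi point** whenever the frame's `C²` size is within the flat radius (`A ≤ klFlatR = 1/20`). -/
theorem klFlatCutoffFn_klFermiPoint (hAR : A ≤ klFlatR) (θ : ℝ) : klFlatCutoffFn μ (klFermiPoint μ K θ) = 1 :=
  klFlatCutoffFn_eq_one_of_abs_le (by
    rw [freeBandFn_klFermiPoint_sub B hA hlo hhi θ]
    exact (abs_eval_klFermiPoint_le hA θ).trans hAR)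

/-- **A `2π`-periodic profile read at the polar angle of (the centred representative of) the Fermi point is its value at `θ`.** -/
theorem apply_polarAngle_centredRep_klFermiPoint {f : ℝ → ℝ} (hper : Function.Periodic f (2 * π)) (θ : ℝ) :
    f (polarAngle (centredRep (klFermiPoint μ K θ))) = f θ := by
  rw [centredRep_eq_self_of_abs_lt (abs_klFermiPoint_lt_pi B hA hlo hhi θ)]
  exact apply_polarAngle_smul_dir hper (frameRadius_pos B hA hlo hhi θ) θ

/-- **THE G-EXTENSION READS ITS PROFILE AT THE FERMI POINT**: `klFrameExtFn μ f (q_θ) = f θ` for every `2π`-periodic `f` (`A ≤ klFlatR`). -/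
theorem klFrameExtFn_apply_klFermiPoint (hAR : A ≤ klFlatR) {f : ℝ → ℝ} (hper : Function.Periodic f (2 * π)) (θ : ℝ) :
    klFrameExtFn μ f (klFermiPoint μ K θ) = f θ := by
  rw [klFrameExtFn_apply_of_cutoff_eq_one f (klFlatCutoffFn_klFermiPoint B hA hlo hhi hAR θ),
    apply_polarAngle_centredRep_klFermiPoint B hA hlo hhi hper θ]

/-- **`D_n(K.eval)(q_θ) = ν_n(K)(θ)`**: the de-interpolated two-leg output at `K.eval`, read at the Fermi point, IS the local part. -/
theorem klTwoLegPolyFn_eval_apply_klFermiPoint (hAR : A ≤ klFlatR) (L M : ℕ) [NeZero L] [NeZero M] (β U : ℝ) (n : ℕ) (θ : ℝ) :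
    klTwoLegPolyFn L M β U μ K.eval n (klFermiPoint μ K θ) = klLocalPart L M β U μ K n θ := by
  rw [klTwoLegPolyFn_eval]
  exact klFrameExtFn_apply_klFermiPoint B hA hlo hhi hAR (klLocalPart_periodic β U μ K n) θ

/-- **`P(K.eval)(q_θ) = K(q_θ)`**: the normal form at `K.eval`, read at the Fermi point, IS the frame there. -/
theorem klFrameProjFn_eval_apply_klFermiPoint (hAR : A ≤ klFlatR) (θ : ℝ) :
    klFrameProjFn μ K.eval (klFermiPoint μ K θ) = K.eval (klFermiPoint μ K θ) := by
  rw [klFrameProjFn, klFermiPointFn_eval]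
  exact klFrameExtFn_apply_klFermiPoint B hA hlo hhi hAR (frameOnCurve_periodic μ K) θ

/-- **The partial sum of the function pieces at the Fermi point**: `Σ_{i ≤ n} ℓ_i^{Fn}(K.eval)(q_θ) = ν_n(K)(θ) − K(q_θ)`. -/
theorem sum_klTwoLegPieceFn_eval_apply_klFermiPoint (hAR : A ≤ klFlatR) (L M : ℕ) [NeZero L] [NeZero M] (β U : ℝ) (n : ℕ)
    (θ : ℝ) :
    ∑ i ∈ range (n + 1), klTwoLegPieceFn L M β U μ K.eval i (klFermiPoint μ K θ) =
      klLocalPart L M β U μ K n θ - K.eval (klFermiPoint μ K θ) := by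
  have h := congrFun (sum_klTwoLegPieceFn L M β U μ K.eval n) (klFermiPoint μ K θ)
  rw [Finset.sum_apply] at h
  rw [h, Pi.sub_apply, klTwoLegPolyFn_eval_apply_klFermiPoint B hA hlo hhi hAR,
    klFrameProjFn_eval_apply_klFermiPoint B hA hlo hhi hAR]

/-- **THE READING IDENTITY.**  For a frame `K` under the explicit frame hypotheses with `A ≤ klFlatR`, every volume, scale and angle:
`ν_n(K)(θ) = K(q_θ) + Σ_{i ≤ n} ℓ_i^{Fn}(K.eval)(q_θ)` at the frame's Fermi point `q_θ = klFermiPoint μ K θ` — EXACTLY (the (R-I-min)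
replacement of the reading inequality `abs_klLocalPart_sub_partialSum_le`: no `1/L` term, no Lipschitz data, no volume condition). -/
theorem klLocalPart_eq_eval_add_sum_pieceFn (hAR : A ≤ klFlatR) (L M : ℕ) [NeZero L] [NeZero M] (β U : ℝ) (n : ℕ) (θ : ℝ) :
    klLocalPart L M β U μ K n θ =
      K.eval (klFermiPoint μ K θ) + ∑ i ∈ range (n + 1), klTwoLegPieceFn L M β U μ K.eval i (klFermiPoint μ K θ) := by
  rw [sum_klTwoLegPieceFn_eval_apply_klFermiPoint B hA hlo hhi hAR]
  ring

/-- The scale-`0` piece at the Fermi point: `ℓ_0^{Fn}(K.eval)(q_θ) = ν_0(K)(θ) − K(q_θ)`. -/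
theorem klTwoLegPieceFn_eval_apply_klFermiPoint_zero (hAR : A ≤ klFlatR) (L M : ℕ) [NeZero L] [NeZero M] (β U : ℝ) (θ : ℝ) :
    klTwoLegPieceFn L M β U μ K.eval 0 (klFermiPoint μ K θ) = klLocalPart L M β U μ K 0 θ - K.eval (klFermiPoint μ K θ) := by
  rw [klTwoLegPieceFn_zero, Pi.sub_apply, klTwoLegPolyFn_eval_apply_klFermiPoint B hA hlo hhi hAR,
    klFrameProjFn_eval_apply_klFermiPoint B hA hlo hhi hAR]

/-- The scale-`(n+1)` piece at the Fermi point: `ℓ_{n+1}^{Fn}(K.eval)(q_θ) = ν_{n+1}(K)(θ) − ν_n(K)(θ)` (the δμ-flow increment plus the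
mean-free increment, read exactly). -/
theorem klTwoLegPieceFn_eval_apply_klFermiPoint_succ (hAR : A ≤ klFlatR) (L M : ℕ) [NeZero L] [NeZero M] (β U : ℝ) (n : ℕ)
    (θ : ℝ) :
    klTwoLegPieceFn L M β U μ K.eval (n + 1) (klFermiPoint μ K θ) =
      klLocalPart L M β U μ K (n + 1) θ - klLocalPart L M β U μ K n θ := by
  rw [klTwoLegPieceFn_succ, Pi.sub_apply, klTwoLegPolyFn_eval_apply_klFermiPoint B hA hlo hhi hAR,
    klTwoLegPolyFn_eval_apply_klFermiPoint B hA hlo hhi hAR]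

/-- **Renormalisation from the partial sum, pointwise**: a bound `B₀` of `|K(q_θ) + Σ_{i ≤ n} ℓ_i^{Fn}(K.eval)(q_θ)|` at the Fermi point
bounds `|ν_n(K)(θ)|` by the SAME `B₀`. -/
theorem abs_klLocalPart_le_of_partialSumFn (hAR : A ≤ klFlatR) (L M : ℕ) [NeZero L] [NeZero M] (β U : ℝ) (n : ℕ) (θ : ℝ)
    {B₀ : ℝ} (hB : |K.eval (klFermiPoint μ K θ) +
      ∑ i ∈ range (n + 1), klTwoLegPieceFn L M β U μ K.eval i (klFermiPoint μ K θ)| ≤ B₀) :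
    |klLocalPart L M β U μ K n θ| ≤ B₀ := by
  rwa [klLocalPart_eq_eval_add_sum_pieceFn B hA hlo hhi hAR]

/-- **THE GATE LEMMA, (R-I-min)**: a UNIFORM sup bound `B₀` of the function `K.eval + Σ_{i ≤ n} ℓ_i^{Fn}(K.eval)` within the tolerance
`R′.cr·|U|·Λ_n²/e₀` gives `RenormalisedAtF L M β U μ K R′ n` — at EVERY volume (no threshold), for every package `R′`. -/
theorem renormalisedAtF_of_partialSumFn (hAR : A ≤ klFlatR) (L M : ℕ) [NeZero L] [NeZero M] (β U : ℝ) (R' : RenConsts) (n : ℕ)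
    {B₀ : ℝ} (hB : ∀ q : Fin 2 → ℝ, |K.eval q + ∑ i ∈ range (n + 1), klTwoLegPieceFn L M β U μ K.eval i q| ≤ B₀)
    (htol : B₀ ≤ R'.cr * |U| * klScale klE0 n ^ 2 / klE0) : RenormalisedAtF L M β U μ K R' n := fun θ =>
  (abs_klLocalPart_le_of_partialSumFn B hA hlo hhi hAR L M β U n θ (hB _)).trans htol

end Frame

/-! ## §2 In the KL regime, keyed by `FrameOK` -/

/-- **THE READING IDENTITY KEYED BY `FrameOK` IN THE KL REGIME.**  For every `R` (`Gfr ≥ 0`) there are volume/β/U/frame-free `c₃, U₀ > 0`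
such that for `0 < c ≤ c₃`, `0 < U ≤ U₀`, `klBetaMin ≤ β ≤ e^{c/U²}`, every `μ ∈ klWindowC`, every frame with `FrameOK R U (nScales β) ν K`
(any `ν`), EVERY volume `(L, M)`, scale `n` and angle `θ`:
`ν_n(K)(θ) = K(q_θ) + Σ_{i ≤ n} ℓ_i^{Fn}(K.eval)(q_θ)`, `q_θ = klFermiPoint μ K θ`.  (The `C²` size of an admissible frame in the regime is
`A = 2·Gfr 0·U + 2·Gfr 1·U² + Gfr 2·c/log 4 ≤ 1/20 = klFlatR`, `frame_thresholds` with `κ = 1/5`; the window's margin `klWindowC_margin`.) -/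
theorem klLocalPart_eq_partialSumFn_of_frameOK (R : RenConsts) (hR : ∀ j, 0 ≤ R.Gfr j) :
    ∃ c₃ : ℝ, 0 < c₃ ∧ ∃ U₀ : ℝ, 0 < U₀ ∧
      ∀ c : ℝ, 0 < c → c ≤ c₃ → ∀ U : ℝ, 0 < U → U ≤ U₀ → ∀ β : ℝ, klBetaMin ≤ β → β ≤ Real.exp (c / U ^ 2) →
      ∀ μ ∈ klWindowC, ∀ (ν : ℝ) (K : TrigPolyC4v), FrameOK R U (nScales β) ν K →
      ∀ (L M : ℕ) [NeZero L] [NeZero M] (n : ℕ) (θ : ℝ),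
        klLocalPart L M β U μ K n θ =
          K.eval (klFermiPoint μ K θ) + ∑ i ∈ range (n + 1), klTwoLegPieceFn L M β U μ K.eval i (klFermiPoint μ K θ) := by
  have ha : (-4 : ℝ) < -1.1 := by norm_num
  have hab : (-1.1 : ℝ) ≤ -0.1 := by norm_num
  have hb : (-0.1 : ℝ) < 0 := by norm_num
  set B := bandBounds ha hab hb with hBdef
  have hκ : (0 : ℝ) < 1 / 5 := by norm_num
  obtain ⟨c₃, hc₃, U₀, hU₀, hthr⟩ := frame_thresholds hR hκ
  refine ⟨c₃, hc₃, U₀, hU₀, ?_⟩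
  intro c hc hcle U hU hUle β hβmin hβc μ hμ ν K hK L M _ _ n θ
  -- the `C²` size of the frame in the regime
  have hAf : ∀ p : Momentum, ∀ j ≤ 2, ‖iteratedFDeriv ℝ j (frameShift K) p‖ ≤
      2 * R.Gfr 0 * |U| + 2 * R.Gfr 1 * U ^ 2 + R.Gfr 2 * (c / Real.log 4) := fun p j hj =>
    norm_iteratedFDeriv_frameShift_le_of_frameOK_regime hR hc.le hβmin hβc hK p hj
  set A := 2 * R.Gfr 0 * |U| + 2 * R.Gfr 1 * U ^ 2 + R.Gfr 2 * (c / Real.log 4) with hAdef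
  have h4A : 4 * A ≤ 1 / 5 := hthr c U hc.le hcle hU hUle
  have hA20 : A ≤ 1 / 20 := by linarith
  have hAR : A ≤ klFlatR := by rw [klFlatR]; exact hA20
  obtain ⟨hlo, hhi⟩ := PerturbedFermiCurve.klWindowC_margin hμ hA20
  exact klLocalPart_eq_eval_add_sum_pieceFn B hAf hlo hhi hAR L M β U n θ

/-- **THE GATE LEMMA KEYED BY `FrameOK` IN THE KL REGIME, (R-I-min).**  Same thresholds; for every admissible frame, EVERY volume, every
package `R′` and scale `n`: a uniform sup bound `B₀` of `K.eval + Σ_{i ≤ n} ℓ_i^{Fn}(K.eval)` with `B₀ ≤ R′.cr·|U|·Λ_n²/e₀` gives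
`RenormalisedAtF L M β U μ K R′ n` (replaces `renormalisedAtF_of_partialSum_frameOK`: no `L ≥ max(20, 8π/klFlatR)`, no `2π/L < r₀`, no
`Λ_ν`, `Λ_ℓ`, `Λ_K`). -/
theorem renormalisedAtF_of_partialSumFn_frameOK (R : RenConsts) (hR : ∀ j, 0 ≤ R.Gfr j) :
    ∃ c₃ : ℝ, 0 < c₃ ∧ ∃ U₀ : ℝ, 0 < U₀ ∧
      ∀ c : ℝ, 0 < c → c ≤ c₃ → ∀ U : ℝ, 0 < U → U ≤ U₀ → ∀ β : ℝ, klBetaMin ≤ β → β ≤ Real.exp (c / U ^ 2) →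
      ∀ μ ∈ klWindowC, ∀ (ν : ℝ) (K : TrigPolyC4v), FrameOK R U (nScales β) ν K →
      ∀ (L M : ℕ) [NeZero L] [NeZero M] (R' : RenConsts) (n : ℕ) (B₀ : ℝ),
        (∀ q : Fin 2 → ℝ, |K.eval q + ∑ i ∈ range (n + 1), klTwoLegPieceFn L M β U μ K.eval i q| ≤ B₀) →
        B₀ ≤ R'.cr * |U| * klScale klE0 n ^ 2 / klE0 → RenormalisedAtF L M β U μ K R' n := by
  obtain ⟨c₃, hc₃, U₀, hU₀, h⟩ := klLocalPart_eq_partialSumFn_of_frameOK R hR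
  refine ⟨c₃, hc₃, U₀, hU₀, ?_⟩
  intro c hc hcle U hU hUle β hβmin hβc μ hμ ν K hK L M _ _ R' n B₀ hB htol θ
  rw [h c hc hcle U hU hUle β hβmin hβc μ hμ ν K hK L M n θ]
  exact (hB _).trans htol

/-- **Pointwise form keyed by `FrameOK`**: `|ν_n(K)(θ)| ≤ |K(q_θ) + Σ_{i ≤ n} ℓ_i^{Fn}(K.eval)(q_θ)|` — with EQUALITY (the shape
`ct_reading_of_blockHA` consumes, its `W/L` term now `0`). -/
theorem abs_klLocalPart_le_of_partialSumFn_frameOK (R : RenConsts) (hR : ∀ j, 0 ≤ R.Gfr j) :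
    ∃ c₃ : ℝ, 0 < c₃ ∧ ∃ U₀ : ℝ, 0 < U₀ ∧
      ∀ c : ℝ, 0 < c → c ≤ c₃ → ∀ U : ℝ, 0 < U → U ≤ U₀ → ∀ β : ℝ, klBetaMin ≤ β → β ≤ Real.exp (c / U ^ 2) →
      ∀ μ ∈ klWindowC, ∀ (ν : ℝ) (K : TrigPolyC4v), FrameOK R U (nScales β) ν K →
      ∀ (L M : ℕ) [NeZero L] [NeZero M] (n : ℕ) (θ : ℝ),
        |klLocalPart L M β U μ K n θ| =
          |K.eval (klFermiPoint μ K θ) + ∑ i ∈ range (n + 1), klTwoLegPieceFn L M β U μ K.eval i (klFermiPoint μ K θ)| := by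
  obtain ⟨c₃, hc₃, U₀, hU₀, h⟩ := klLocalPart_eq_partialSumFn_of_frameOK R hR
  refine ⟨c₃, hc₃, U₀, hU₀, ?_⟩
  intro c hc hcle U hU hUle β hβmin hβc μ hμ ν K hK L M _ _ n θ
  rw [h c hc hcle U hU hUle β hβmin hβc μ hμ ν K hK L M n θ]

/-! ## §3 The δμ-flow read at the zone centre (function pieces) -/

/-- The free band at the zone centre: `ε(Γ) = −4`. -/
theorem freeBandFn_zero : freeBandFn (0 : Fin 2 → ℝ) = -4 := by
  norm_num [freeBandFn]

/-- **The G-extension reads its constant piece at the zone centre**: for `μ ≥ −3.9` the doubled tube misses `Γ`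
(`|ε(Γ) − μ| = 4 + μ ≥ 1/10 = 2·klFlatR`), so `klFrameExtFn μ f 0 = klAngularMean f` — for EVERY profile `f`. -/
theorem klFrameExtFn_apply_zero {μ : ℝ} (hμ : -(39 / 10) ≤ μ) (f : ℝ → ℝ) : klFrameExtFn μ f 0 = klAngularMean f := by
  refine klFrameExtFn_apply_of_far f ?_
  rw [freeBandFn_zero, klFlatR, show (-4 : ℝ) - μ = -(4 + μ) by ring, abs_neg, abs_of_nonneg (by linarith)]
  linarith

section Model

variable {L M : ℕ} [NeZero L] [NeZero M]

/-- **`D_n(K.eval)(Γ) = mean ν_n(K)`**: the two-leg output's value at the zone centre is the angular mean of the local part (the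
scale-`n` δμ). -/
theorem klTwoLegPolyFn_eval_apply_zero {μ : ℝ} (hμ : -(39 / 10) ≤ μ) (β U : ℝ) (K : TrigPolyC4v) (n : ℕ) :
    klTwoLegPolyFn L M β U μ K.eval n 0 = klAngularMean (klLocalPart L M β U μ K n) := by
  rw [klTwoLegPolyFn_eval, klFrameExtFn_apply_zero hμ]

omit [NeZero L] [NeZero M] in
/-- **`P(K.eval)(Γ) = mean (K ∘ k_F^K)`**: the normal form's value at the zone centre is the angular mean of the frame on its curve. -/
theorem klFrameProjFn_eval_apply_zero {μ : ℝ} (hμ : -(39 / 10) ≤ μ) (K : TrigPolyC4v) :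
    klFrameProjFn μ K.eval 0 = klAngularMean (fun θ => K.eval (klFermiPoint μ K θ)) := by
  rw [klFrameProjFn, klFermiPointFn_eval, klFrameExtFn_apply_zero hμ]

/-- **THE δμ FLOW IS THE PIECES' VALUE AT `Γ`**: `Σ_{i ≤ n} ℓ_i^{Fn}(K.eval)(0) = mean ν_n(K) − mean (K ∘ k_F^K)` (`μ ≥ −3.9`; no
integrability hypothesis — the telescoping is pointwise). -/
theorem sum_klTwoLegPieceFn_eval_apply_zero {μ : ℝ} (hμ : -(39 / 10) ≤ μ) (β U : ℝ) (K : TrigPolyC4v) (n : ℕ) :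
    ∑ i ∈ range (n + 1), klTwoLegPieceFn L M β U μ K.eval i 0 =
      klAngularMean (klLocalPart L M β U μ K n) - klAngularMean (fun θ => K.eval (klFermiPoint μ K θ)) := by
  have h := congrFun (sum_klTwoLegPieceFn L M β U μ K.eval n) 0
  rw [Finset.sum_apply] at h
  rw [h, Pi.sub_apply, klTwoLegPolyFn_eval_apply_zero hμ, klFrameProjFn_eval_apply_zero hμ]

/-- The scale-`(n+1)` δμ increment: `ℓ_{n+1}^{Fn}(K.eval)(0) = mean ν_{n+1}(K) − mean ν_n(K)`. -/
theorem klTwoLegPieceFn_eval_apply_zero_succ {μ : ℝ} (hμ : -(39 / 10) ≤ μ) (β U : ℝ) (K : TrigPolyC4v) (n : ℕ) :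
    klTwoLegPieceFn L M β U μ K.eval (n + 1) 0 =
      klAngularMean (klLocalPart L M β U μ K (n + 1)) - klAngularMean (klLocalPart L M β U μ K n) := by
  rw [klTwoLegPieceFn_succ, Pi.sub_apply, klTwoLegPolyFn_eval_apply_zero hμ, klTwoLegPolyFn_eval_apply_zero hμ]

/-- On the covariance window `klWindowC = [−1.05, −0.15]` the zone-centre condition `μ ≥ −3.9` holds. -/
theorem neg_39_div_10_le_of_mem_klWindowC {μ : ℝ} (hμ : μ ∈ klWindowC) : -(39 / 10 : ℝ) ≤ μ := by
  have h := hμ.1; norm_num at h ⊢; linarith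

end Model

/-! ## §4 The reading hypothesis of the one-volume continuation, (R-I-min) shape (`wig := 0`) -/

/-- **THE `hread` BLOCK OF THE CONTINUATION, DISCHARGED** (the shape `ct_stepHA` / `ct_exists_postHA` / `ct_oneVolume_of_readingHA` consume,
with the function pieces and slack `0`): for every `R` (`Gfr ≥ 0`) there are `c₃, U₀ > 0` such that in the regime, for every `μ ∈ klWindowC`
and EVERY volume `(L, M)`: every admissible frame `K` (`FrameOK R U (nScales β) μ K`), every scale `n ≤ nScales β` (the renormalisation
history below `n` is NOT needed and is accepted only to match the block's binder), every uniform sup bound `B` of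
`K.eval + Σ_{i ≤ n} ℓ_i^{Fn}(K.eval)` bounds `|ν_n(K)(θ)|` by `B` at every real angle. -/
theorem ct_hreadFn_of_frameOK (R : RenConsts) (hR : ∀ j, 0 ≤ R.Gfr j) :
    ∃ c₃ : ℝ, 0 < c₃ ∧ ∃ U₀ : ℝ, 0 < U₀ ∧
      ∀ c : ℝ, 0 < c → c ≤ c₃ → ∀ U : ℝ, 0 < U → U ≤ U₀ → ∀ β : ℝ, klBetaMin ≤ β → β ≤ Real.exp (c / U ^ 2) →
      ∀ μ ∈ klWindowC, ∀ (L M : ℕ) [NeZero L] [NeZero M],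
        ∀ K : TrigPolyC4v, FrameOK R U (nScales β) μ K → ∀ n : ℕ, n ≤ nScales β →
          (∀ j < n, RenormalisedAtF L M β U μ K R j) → ∀ B : ℝ,
            (∀ q : Fin 2 → ℝ, |K.eval q + ∑ i ∈ range (n + 1), klTwoLegPieceFn L M β U μ K.eval i q| ≤ B) →
              ∀ θ : ℝ, |klLocalPart L M β U μ K n θ| ≤ B := by
  obtain ⟨c₃, hc₃, U₀, hU₀, h⟩ := klLocalPart_eq_partialSumFn_of_frameOK R hR
  refine ⟨c₃, hc₃, U₀, hU₀, ?_⟩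
  intro c hc hcle U hU hUle β hβmin hβc μ hμ L M _ _ K hK n _ _ B hB θ
  rw [h c hc hcle U hU hUle β hβmin hβc μ hμ μ K hK L M n θ]
  exact hB _

/-- The same with an arbitrary nonnegative slack family `wig` (literally the `hread` binder of `ct_oneVolume_of_readingHA`, function pieces):
`|ν_n(K)(θ)| ≤ B + wig n`. -/
theorem ct_hreadFn_of_frameOK_wig (R : RenConsts) (hR : ∀ j, 0 ≤ R.Gfr j) :
    ∃ c₃ : ℝ, 0 < c₃ ∧ ∃ U₀ : ℝ, 0 < U₀ ∧
      ∀ c : ℝ, 0 < c → c ≤ c₃ → ∀ U : ℝ, 0 < U → U ≤ U₀ → ∀ β : ℝ, klBetaMin ≤ β → β ≤ Real.exp (c / U ^ 2) →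
      ∀ μ ∈ klWindowC, ∀ (L M : ℕ) [NeZero L] [NeZero M] (wig : ℕ → ℝ), (∀ n, 0 ≤ wig n) →
        ∀ K : TrigPolyC4v, FrameOK R U (nScales β) μ K → ∀ n : ℕ, n ≤ nScales β →
          (∀ j < n, RenormalisedAtF L M β U μ K R j) → ∀ B : ℝ,
            (∀ q : Fin 2 → ℝ, |K.eval q + ∑ i ∈ range (n + 1), klTwoLegPieceFn L M β U μ K.eval i q| ≤ B) →
              ∀ θ : ℝ, |klLocalPart L M β U μ K n θ| ≤ B + wig n := by
  obtain ⟨c₃, hc₃, U₀, hU₀, h⟩ := ct_hreadFn_of_frameOK R hR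
  refine ⟨c₃, hc₃, U₀, hU₀, ?_⟩
  intro c hc hcle U hU hUle β hβmin hβc μ hμ L M _ _ wig hwig K hK n hn hren B hB θ
  have h1 := h c hc hcle U hU hUle β hβmin hβc μ hμ L M K hK n hn hren B hB θ
  linarith [hwig n]

end Summit.HubbardSuperconductivity.HubbardSuperconductivity.Theorems.KLRegimeSplit

end
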